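import Literature.NumberTheory.EllipticCurves.ModularParametrization
import Literature.NumberTheory.EllipticCurves.ComplexTorusAddProofs
import Literature.NumberTheory.EllipticCurves.ModularParametrizationDegree
import HarnessLib

/-!
# Modular parametrisations — discharge of the uniformisation leaf

`Literature/NumberTheory/EllipticCurves/ModularParametrization.lean` decomposes the named fact
`Literature.NumberTheory.EllipticCurves.ModularForms.nonempty_modularParametrizationData` (`ModularCurve.lean`; mathematically the
Modularity Theorem of Breuil–Conrad–Diamond–Taylor 2001, Thm. A, in the form (6) of p. 845,
with the Eichler–Shimura construction and the integrality of the Manin constant) into four named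
facts and proves the assembly. Two of the four are now theorems of the tree:

2. `exists_isNeronLatticeOf` — `exists_isNeronLatticeOf_holds`
   (`ModularCurveNeronLatticeProofs.lean`, Silverman AEC VI.5.1);
3. `IsNeronLatticeOf.exists_uniformize` — **discharged here** as
   `IsNeronLatticeOf.exists_uniformize_holds`: Silverman AEC Prop. VI.3.6 — `Δ(Λ) ≠ 0`,
   `z ↦ (℘(z), ℘'(z)/2)` is onto `E_Λ(ℂ)` with fibres the cosets of `Λ` (`ComplexTorus.lean`)
   and additive (`ComplexTorusAddProofs.lean`: the addition theorems for `℘` — the tree's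
   `weierstrassP_add_holds`, `WeierstrassAdditionProofs.lean` — and for `℘'`, by differentiating
   the functional form of the former obtained by ODE uniqueness, against Mathlib's chord-tangent
   law), transported to any model with `c₄ = 12g₂`, `c₆ = 216g₃`.

Hence `nonempty_modularParametrizationData_of_modularity`: the target fact follows from the two
remaining named facts, modularity "Version `a_p`" (`exists_isNewformOf`, BCDT Thm. A (2)) and
the modular parametrisation with integral Manin constant on `ℂ/Λ_E`
(`IsNewformOf.exists_maninConstant_modularDegree`: BCDT Thm. A (6), Knapp Thm. 11.74/12.7,
Edixhoven 1991 Prop. 2, Farkas–Kra I.1.6); and, splitting the latter as in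
`ModularParametrizationDegree.lean`, `nonempty_modularParametrizationData_of_modularity'`: the
target fact from modularity, the commensurability of `Λ_f` and `Λ_E`
(`IsNewformOf.exists_maninConstant_ne_zero`, arithmetic: Eichler–Shimura and Faltings) and the
existence of the modular degree (`exists_modularDegree`, Riemann surface theory of `X₀(N)`).

## References

* C. Breuil, B. Conrad, F. Diamond, R. Taylor, *On the modularity of elliptic curves over `ℚ`:
  wild 3-adic exercises*, J. Amer. Math. Soc. 14 (2001), 843–939: Thm. A, p. 845 (1)–(6).
* J. H. Silverman, *The Arithmetic of Elliptic Curves*, 2nd ed., GTM 106, Springer 2009: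
  Prop. VI.3.6, Cor. VI.5.1.1.
-/

noncomputable section

namespace Literature.NumberTheory.EllipticCurves.ModularForms

/-- **Fact 3 discharged: complex uniformisation as a group homomorphism** (Silverman AEC
Prop. VI.3.6(b) for an arbitrary model `W/ℂ` with `g₂(L) = c₄/12`, `g₃(L) = c₆/216`): the tree's
`PeriodPair.exists_addMonoidHom_of_g₂_g₃'` (`ComplexTorusAddProofs.lean`) — `Δ(Λ) ≠ 0`,
surjectivity of `z ↦ (℘(z), ℘'(z)/2)` by Liouville, kernel `Λ` by ODE uniqueness, additivity
from the addition theorems for `℘`, `℘'` against Mathlib's chord-tangent law, and transport along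
Mathlib's change of variables `W.toShortNF = (1, −b₂/12, −a₁/2, a₁b₂/24 − a₃/2)`.
[cite: SilvermanAEC2009, Prop. VI.3.6(b)] -/
theorem IsNeronLatticeOf.exists_uniformize_holds : IsNeronLatticeOf.exists_uniformize :=
  fun {_} _ {_} hWL ↦ PeriodPair.exists_addMonoidHom_of_g₂_g₃' hWL.1 hWL.2

/-- `nonempty_modularParametrizationData` from the two remaining named facts — **modularity**
(`exists_isNewformOf`, BCDT Thm. A in the form (2)) and the **modular parametrisation with
integral Manin constant** on `ℂ/Λ_E` (`IsNewformOf.exists_maninConstant_modularDegree`: BCDT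
Thm. A (6), Eichler–Shimura, Edixhoven) — the Néron lattice (AEC VI.5.1) and the uniformisation
`ℂ/Λ ≅ E(ℂ)` (AEC VI.3.6) being theorems of the tree. [cite: BCDTJAMS2001, Thm. A] -/
theorem nonempty_modularParametrizationData_of_modularity (h₁ : exists_isNewformOf)
    (h₄ : IsNewformOf.exists_maninConstant_modularDegree) : nonempty_modularParametrizationData :=
  nonempty_modularParametrizationData_of_facts h₁ IsNeronLatticeOf.exists_uniformize_holds h₄

/-- `nonempty_modularParametrizationData` from the three named facts left after this file:
**modularity** "Version `a_p`" (`exists_isNewformOf`), the **commensurability of `Λ_f` and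
`Λ_E`** (`IsNewformOf.exists_maninConstant_ne_zero`: Eichler–Shimura, Faltings, rationality of
the Manin constant) and the **existence of the modular degree** (`exists_modularDegree`: `X₀(N)`
as a compact Riemann surface and the degree of a holomorphic map) — uniformisation being
proved.
[cite: BCDTJAMS2001, Thm. A] -/
theorem nonempty_modularParametrizationData_of_modularity' (h₁ : exists_isNewformOf)
    (ha : IsNewformOf.exists_maninConstant_ne_zero) (hb : exists_modularDegree) :
    nonempty_modularParametrizationData :=
  nonempty_modularParametrizationData_of_facts' h₁ IsNeronLatticeOf.exists_uniformize_holds ha hb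

end Literature.NumberTheory.EllipticCurves.ModularForms

end
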